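import Summits.ResolutionOfSingularities.ResolutionOfSingularities.Theorems.LossEntryW16
import HarnessLib

/-!
# LossEntryW17 (= lens-3 g29 slice 10, part 1) — walk plumbing of the loss→entry law — ISOLATION TRANSFER: sheared and re-cleaned equations keep an isolated top point

decomp-res-lens-3, gen 29 (NODE-g29 §3bis (N5)).  TOOL at 0.  Imports `Theorems.LossEntryW16`.

§29 — ISOLATION TRANSFER (pure algebra over the tree's `taylor` / `hasseDeriv` / `topIdeal` / `IsolatedTop`):
* `taylorShearVars`, `isHomogeneous_taylorShearVars`, **`taylor_shear`** (`(σF)(x+u) = F(σx + σu)`: `taylor ∘ σ_{c,a,g} = (map σ, aeval σ_u) ∘ taylor`);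
* **`hasseDeriv_shear_mem_map`** (CHAIN RULE: for `0 < |d| < q`, `∂^{(d)}(σF) ∈ σ(J_F)`, by homogeneity of the sheared increment monomials);
* `constantCoeff_shear`, **`map_shear_topIdeal_le`** (`σ(J_F) ⊆ J_{σF}`, via `σ^{-1} = σ_{c,a,−g}`), **`isolatedTop_shear`**
  (`IsolatedTop q F → IsolatedTop q (σ_{c,a,g} F)`, `c ≠ a`; the binomial trick `u_c^{2N} ∈ (u_c + g u_a)^N·R + u_a^N·R`);
* `hasseDeriv_monomial_eq_zero_of_isPthPowerExponent` (Lucas), **`topIdeal_deletePthPowers`** (`J_{clean G} = J_G`),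
  **`isolatedTop_deletePthPowers`**; pure polygon helpers `exists_thin_of_isolatedTop`, `polyPts_nonempty_of_thin`,
  `alphaOf_polyPts_lt_one_of_thin`.
(§30, the walk-level discharge of (N5) and the fully discharged step laws, follows in `LossEntryW18`.)
`hLucas` (`q ∣ D`, `q ∤ T` ⇒ `C(D,T) = 0` in `K`) as in slice 4 (discharged from `CharP K p`, `q = p^e` there).
-/

open MvPolynomial Finset
open Literature.AlgebraicGeometry.Resolution
open Literature.AlgebraicGeometry.Resolution.Hauser2010
open Literature.AlgebraicGeometry.Resolution.PointBlowup
open Summit.ResolutionOfSingularities.ResolutionOfSingularities.Theorems.TightDefectClasses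
open Summit.ResolutionOfSingularities.ResolutionOfSingularities.Theorems.TightDefectStrongWalks
open Summit.ResolutionOfSingularities.ResolutionOfSingularities.Theorems.ItineraryCutClasses
open Summit.ResolutionOfSingularities.ResolutionOfSingularities.Theorems.BoundaryLedger
open Summit.ResolutionOfSingularities.ResolutionOfSingularities.Theorems.ProximityCut
open Summit.ResolutionOfSingularities.ResolutionOfSingularities.Theorems.LossExitCone
open Summit.ResolutionOfSingularities.ResolutionOfSingularities.Theorems.LossPolygon

/-! ## §29 ISOLATION TRANSFER — straightened and re-cleaned equations keep an ISOLATED top point, hence every axis witness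
((N5) of NODE-g29 dissolved: `IsolatedTop q` is invariant under the shears `σ_{c,a,g}` and under deleting `q`-th powers) -/

namespace Summit.ResolutionOfSingularities.ResolutionOfSingularities.Theorems.LossPolygon

open MvPolynomial

variable {K : Type} [Field K]

section IsolationTransfer

/-- The substitution of the Taylor (`u`-)variables matching `σ_{c,a,g}`: `u_c ↦ u_c + g u_a`. DEFINITION (support). -/
noncomputable def taylorShearVars (c a : Fin 3) (g : K) : Fin 3 → MvPolynomial (Fin 3) (MvPolynomial (Fin 3) K) :=
  fun w => if w = c then X c + C (C g) * X a else X w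

omit [Field K] in
/-- Each substituted Taylor variable is a LINEAR form. [elementary] -/
theorem isHomogeneous_taylorShearVars [Field K] (c a : Fin 3) (g : K) (w : Fin 3) :
    (taylorShearVars c a g w).IsHomogeneous 1 := by
  unfold taylorShearVars
  split_ifs
  · exact (isHomogeneous_X _ _).add (isHomogeneous_C_mul_X _ _)
  · exact isHomogeneous_X _ _

/-- **TAYLOR ∘ SHEAR = (SHEAR ⊗ SHEAR) ∘ TAYLOR (PROVED):** `(σF)(x + u) = F(σx + σu)` — the Taylor expansion of a sheared polynomial is the
Taylor expansion with BOTH the base variables (coefficients, via `map σ`) and the increment variables (via `taylorShearVars`) sheared.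
[elementary; new] -/
theorem taylor_shear (c a : Fin 3) (g : K) (F : MvPolynomial (Fin 3) K) :
    taylor K (shear c a g F) =
      aeval (taylorShearVars c a g) (MvPolynomial.map (shear c a g).toRingHom (taylor K F)) := by
  have key : (taylor K (σ := Fin 3)).toRingHom.comp (shear c a g).toRingHom =
      (aeval (taylorShearVars c a g)).toRingHom.comp
        ((MvPolynomial.map (shear c a g).toRingHom).comp (taylor K (σ := Fin 3)).toRingHom) := by
    refine MvPolynomial.ringHom_ext (fun r => ?_) (fun w => ?_)
    · have hC : shear c a g (C r) = C r := by
        have := (shear c a g).commutes r; rwa [MvPolynomial.algebraMap_eq] at this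
      simp only [RingHom.comp_apply, AlgHom.toRingHom_eq_coe, AlgHom.coe_toRingHom]
      rw [hC, taylor_C, map_C]
      simp only [AlgHom.coe_toRingHom]
      rw [hC, aeval_C, MvPolynomial.algebraMap_eq]
    · simp only [RingHom.comp_apply, AlgHom.toRingHom_eq_coe, AlgHom.coe_toRingHom]
      rw [shear_X, taylor_X, map_add, map_C, map_X]
      simp only [AlgHom.coe_toRingHom]
      rw [shear_X, map_add, aeval_C, aeval_X]
      unfold taylorShearVars
      by_cases hw : w = c
      · rw [if_pos hw, if_pos hw, map_add, map_mul, taylor_X, taylor_X, taylor_C]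
        rw [MvPolynomial.algebraMap_eq, map_add, map_mul]
        ring
      · rw [if_neg hw, if_neg hw, taylor_X, MvPolynomial.algebraMap_eq]
  exact RingHom.congr_fun key F

/-- **CHAIN RULE FOR SHEARS (PROVED):** a Hasse derivative of order `0 < |d| < q` of `σ_{c,a,g} F` lies in the shear of the top-locus
ideal of `F`: `∂^{(d)}(σF) = Σ_{|α| = |d|} r_{α,d} · σ(∂^{(α)} F)`. [elementary; new] -/
theorem hasseDeriv_shear_mem_map (c a : Fin 3) (g : K) (q : ℕ) (F : MvPolynomial (Fin 3) K) {d : Fin 3 →₀ ℕ}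
    (hd0 : d ≠ 0) (hdq : d.degree < q) :
    hasseDeriv K d (shear c a g F) ∈ Ideal.map (shear c a g) (topIdeal q F) := by
  classical
  rw [hasseDeriv_apply, taylor_shear]
  rw [(taylor K F).as_sum]
  rw [map_sum, map_sum, coeff_sum]
  refine Ideal.sum_mem _ fun α _ => ?_
  rw [map_monomial, aeval_monomial, MvPolynomial.algebraMap_eq, coeff_C_mul]
  simp only [AlgHom.toRingHom_eq_coe, AlgHom.coe_toRingHom]
  rw [← hasseDeriv_apply]
  by_cases hdeg : α.degree = d.degree
  · have hα0 : α ≠ 0 := by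
      rintro rfl
      rw [map_zero] at hdeg
      exact hd0 ((Finsupp.degree_eq_zero_iff d).mp hdeg.symm)
    have hmem : hasseDeriv K α F ∈ topIdeal q F :=
      Ideal.subset_span ⟨α, ⟨hα0, by rw [hdeg]; exact hdq⟩, rfl⟩
    exact Ideal.mul_mem_right _ _ (Ideal.mem_map_of_mem _ hmem)
  · have hP : (α.prod fun n e => taylorShearVars c a g n ^ e).IsHomogeneous α.degree := by
      have h := IsHomogeneous.prod α.support (fun n => taylorShearVars c a g n ^ α n) (fun n => 1 * α n)
        (fun n _ => (isHomogeneous_taylorShearVars c a g n).pow (α n))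
      simp only [one_mul] at h
      rw [Finsupp.degree]
      exact h
    rw [hP.coeff_eq_zero (Ne.symm hdeg), mul_zero]
    exact Ideal.zero_mem _

/-- Constant coefficients are shear-invariant (the shear fixes the origin). [elementary] -/
theorem constantCoeff_shear (c a : Fin 3) (g : K) (G : MvPolynomial (Fin 3) K) :
    constantCoeff (shear c a g G) = constantCoeff G := by
  have key : (constantCoeff : MvPolynomial (Fin 3) K →+* K).comp (shear c a g).toRingHom = constantCoeff := by
    refine MvPolynomial.ringHom_ext (fun r => ?_) (fun w => ?_)
    · have hC : shear c a g (C r) = C r := by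
        have := (shear c a g).commutes r; rwa [MvPolynomial.algebraMap_eq] at this
      simp only [RingHom.comp_apply, AlgHom.toRingHom_eq_coe, AlgHom.coe_toRingHom]
      rw [hC]
    · simp only [RingHom.comp_apply, AlgHom.toRingHom_eq_coe, AlgHom.coe_toRingHom]
      rw [shear_X]
      split_ifs <;> simp
  exact RingHom.congr_fun key G

/-- **THE TOP-LOCUS IDEAL IS SHEAR-COVARIANT (PROVED):** `σ(J_F) ⊆ J_{σF}` for `σ = σ_{c,a,g}`, `c ≠ a` (chain rule for `σ^{-1} = σ_{c,a,−g}`).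
[elementary; new] -/
theorem map_shear_topIdeal_le {c a : Fin 3} (hca : c ≠ a) (g : K) (q : ℕ) (F : MvPolynomial (Fin 3) K) :
    Ideal.map (shear c a g) (topIdeal q F) ≤ topIdeal q (shear c a g F) := by
  classical
  have hinv : ∀ G : MvPolynomial (Fin 3) K, shear c a g (shear c a (-g) G) = G := fun G => by
    rw [shear_shear_same hca, neg_add_cancel, shear_zero]
  rw [topIdeal, Ideal.map_span]
  refine Ideal.span_le.mpr ?_
  rintro _ ⟨_, ⟨d, ⟨hd0, hdq⟩, rfl⟩, rfl⟩
  have h := hasseDeriv_shear_mem_map c a (-g) q (shear c a g F) hd0 hdq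
  rw [shear_shear_same hca, add_neg_cancel, shear_zero] at h
  have hle2 : Ideal.map (shear c a g) (Ideal.map (shear c a (-g)) (topIdeal q (shear c a g F))) ≤
      topIdeal q (shear c a g F) :=
    Ideal.map_le_iff_le_comap.mpr (Ideal.map_le_iff_le_comap.mpr fun y hy => by
      rw [Ideal.mem_comap, Ideal.mem_comap, hinv]; exact hy)
  exact hle2 (Ideal.mem_map_of_mem _ h)

/-- **ISOLATION IS SHEAR-INVARIANT (PROVED):** an isolated top point stays isolated after `σ_{c,a,g}` (`c ≠ a`). [elementary; new] -/
theorem isolatedTop_shear {c a : Fin 3} (hca : c ≠ a) (g : K) {q : ℕ} {F : MvPolynomial (Fin 3) K}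
    (h : IsolatedTop q F) : IsolatedTop q (shear c a g F) := by
  classical
  obtain ⟨N, g₀, hg₀, hmem⟩ := h
  have hle := map_shear_topIdeal_le hca g q F
  have hmem' : ∀ i, shear c a g g₀ * shear c a g (X i) ^ N ∈ topIdeal q (shear c a g F) := fun i => by
    have := hle (Ideal.mem_map_of_mem (shear c a g) (hmem i))
    rwa [map_mul, map_pow] at this
  refine ⟨2 * N, shear c a g g₀, by rw [constantCoeff_shear]; exact hg₀, fun i => ?_⟩
  by_cases hi : i = c
  · rw [hi]
    have hA := hmem' c
    have hB := hmem' a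
    rw [shear_X, if_pos rfl] at hA
    rw [shear_X, if_neg hca.symm] at hB
    have hX : (X c : MvPolynomial (Fin 3) K) = (X c + C g * X a) + C (-g) * X a := by rw [C_neg]; ring
    rw [hX, add_pow, Finset.mul_sum]
    refine Ideal.sum_mem _ fun k hk => ?_
    rw [Finset.mem_range] at hk
    by_cases hNk : N ≤ k
    · obtain ⟨m, rfl⟩ := Nat.exists_eq_add_of_le hNk
      have : shear c a g g₀ * ((X c + C g * X a) ^ (N + m) * (C (-g) * X a) ^ (2 * N - (N + m)) *
            (((2 * N).choose (N + m) : ℕ) : MvPolynomial (Fin 3) K)) =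
          shear c a g g₀ * (X c + C g * X a) ^ N *
            ((X c + C g * X a) ^ m * (C (-g) * X a) ^ (2 * N - (N + m)) *
              (((2 * N).choose (N + m) : ℕ) : MvPolynomial (Fin 3) K)) := by
        ring
      rw [this]
      exact Ideal.mul_mem_right _ _ hA
    · have hle' : N ≤ 2 * N - k := by omega
      obtain ⟨m, hm⟩ := Nat.exists_eq_add_of_le hle'
      have : shear c a g g₀ * ((X c + C g * X a) ^ k * (C (-g) * X a) ^ (2 * N - k) *
            (((2 * N).choose k : ℕ) : MvPolynomial (Fin 3) K)) =
          shear c a g g₀ * X a ^ N *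
            (C (-g) ^ N * X a ^ m * C (-g) ^ m * (X c + C g * X a) ^ k *
              (((2 * N).choose k : ℕ) : MvPolynomial (Fin 3) K)) := by
        rw [hm]; ring
      rw [this]
      exact Ideal.mul_mem_right _ _ hB
  · have hA := hmem' i
    rw [shear_X, if_neg hi] at hA
    have : shear c a g g₀ * X i ^ (2 * N) = shear c a g g₀ * X i ^ N * X i ^ N := by rw [two_mul, pow_add, mul_assoc]
    rw [this]
    exact Ideal.mul_mem_right _ _ hA

/-- **Hasse derivatives of order `0 < |d| < q` do not see `q`-th power monomials (PROVED, Lucas).** [elementary] -/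
theorem hasseDeriv_monomial_eq_zero_of_isPthPowerExponent {q : ℕ}
    (hLucas : ∀ D T : ℕ, q ∣ D → ¬ q ∣ T → ((D.choose T : ℕ) : K) = 0) {E d : Fin 3 →₀ ℕ}
    (hE : IsPthPowerExponent q E) (hd0 : d ≠ 0) (hdq : d.degree < q) (r : K) :
    hasseDeriv K d (monomial E r) = 0 := by
  classical
  rw [hasseDeriv_monomial]
  obtain ⟨i, hi⟩ := Finsupp.support_nonempty_iff.mpr hd0
  have hdi : 0 < d i := Nat.pos_of_ne_zero (Finsupp.mem_support_iff.mp hi)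
  have hdi' : d i < q := lt_of_le_of_lt (Finsupp.le_degree i d) hdq
  have hq : ((E i).choose (d i) : K) = 0 :=
    hLucas _ _ ((isPthPowerExponent_iff q E).mp hE i) (fun h => absurd (Nat.le_of_dvd hdi h) (not_le.mpr hdi'))
  have : ((∏ j ∈ d.support, (E j).choose (d j) : ℕ) : MvPolynomial (Fin 3) K) = 0 := by
    rw [Nat.cast_prod, Finset.prod_eq_zero hi]
    rw [← map_natCast (C : K →+* MvPolynomial (Fin 3) K), hq, map_zero]
  rw [this, zero_mul]

/-- **THE TOP-LOCUS IDEAL DOES NOT SEE `q`-TH POWERS (PROVED):** `J_{clean G} = J_G`. [elementary; new] -/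
theorem topIdeal_deletePthPowers {q : ℕ} (hLucas : ∀ D T : ℕ, q ∣ D → ¬ q ∣ T → ((D.choose T : ℕ) : K) = 0)
    (G : MvPolynomial (Fin 3) K) : topIdeal q (deletePthPowers q G) = topIdeal q G := by
  classical
  have key : ∀ d : Fin 3 →₀ ℕ, d ≠ 0 → d.degree < q →
      hasseDeriv K d (deletePthPowers q G) = hasseDeriv K d G := by
    intro d hd0 hdq
    have hG : G = deletePthPowers q G + ∑ E ∈ G.support with IsPthPowerExponent q E, monomial E (coeff E G) := by
      rw [deletePthPowers, add_comm, Finset.sum_filter_add_sum_filter_not]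
      exact G.as_sum
    conv_rhs => rw [hG]
    rw [map_add, map_sum, Finset.sum_eq_zero (fun E hE => ?_), add_zero]
    rw [Finset.mem_filter] at hE
    exact hasseDeriv_monomial_eq_zero_of_isPthPowerExponent hLucas hE.2 hd0 hdq _
  unfold topIdeal
  congr 1
  exact Set.EqOn.image_eq fun d hd => key d hd.1 hd.2

/-- **ISOLATION SURVIVES CLEANING (PROVED).** [elementary; new] -/
theorem isolatedTop_deletePthPowers {q : ℕ} (hLucas : ∀ D T : ℕ, q ∣ D → ¬ q ∣ T → ((D.choose T : ℕ) : K) = 0)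
    {G : MvPolynomial (Fin 3) K} (h : IsolatedTop q G) : IsolatedTop q (deletePthPowers q G) := by
  unfold IsolatedTop at h ⊢
  rw [topIdeal_deletePthPowers hLucas]
  exact h

/-- **THIN MONOMIAL FROM ISOLATION, pure form (PROVED):** an isolated top point, a wall `r_a` dividing every monomial's `a`-exponent,
`r_c = 0` and a heavy wall `q ≤ s + r_a` give a monomial below the ceiling of the frame `(a, · ; c)` and strictly inside the simplex
`D_a + D_c < s + r_a` (cf. `exists_thin_mem_support` for walk states). [new] -/
theorem exists_thin_of_isolatedTop [DecidableEq K] {q s : ℕ} {a c : Fin 3} (hac : a ≠ c) {r : Fin 3 →₀ ℕ} (hrc : r c = 0)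
    {F : MvPolynomial (Fin 3) K} (hiso : IsolatedTop q F) (hwall : ∀ D ∈ F.support, r a ≤ D a) (hq : q ≤ s + r a) :
    ∃ D ∈ F.support, D c < s + r c ∧ D a + D c < s + r a := by
  obtain ⟨D, hD, hlt⟩ := ConeCutAxisLaw.exists_support_pair_lt_of_isolatedTop hiso a c hac
  have := hwall D hD
  exact ⟨D, hD, by rw [hrc]; omega, by omega⟩

/-- A thin monomial makes the point set non-empty … [elementary] -/
theorem polyPts_nonempty_of_thin {s : ℕ} {r : Fin 3 →₀ ℕ} {a c : Fin 3} (b : Fin 3) {F : MvPolynomial (Fin 3) K}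
    {D : Fin 3 →₀ ℕ} (hD : D ∈ F.support) (hDc : D c < s + r c) : (polyPts s r a b c F).Nonempty := by
  classical
  exact ⟨_, Finset.mem_image_of_mem _ (Finset.mem_filter.mpr ⟨hD, hDc⟩)⟩

/-- … and forces `α < 1` (pure form of `alphaOf_polyPts_lt_one`). [new] -/
theorem alphaOf_polyPts_lt_one_of_thin {s : ℕ} {r : Fin 3 →₀ ℕ} {a c : Fin 3} (b : Fin 3) (hrc : r c = 0)
    {F : MvPolynomial (Fin 3) K} {D : Fin 3 →₀ ℕ} (hD : D ∈ F.support) (hDc : D c < s + r c) (hthin : D a + D c < s + r a) :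
    alphaOf (polyPts s r a b c F) < 1 := by
  classical
  have hmem : resPoint s r a b c D ∈ polyPts s r a b c F := Finset.mem_image_of_mem _ (Finset.mem_filter.mpr ⟨hD, hDc⟩)
  refine lt_of_le_of_lt (alphaOf_le_fst hmem) ?_
  show (((D a : ℕ) : ℚ) - r a) / (((s : ℕ) : ℚ) + r c - D c) < 1
  rw [hrc] at hDc
  have hden : (0 : ℚ) < ((s : ℕ) : ℚ) + r c - D c := by
    rw [hrc]; push_cast
    have : ((D c : ℕ) : ℚ) < s := by exact_mod_cast (by omega : D c < s)
    linarith
  rw [div_lt_one hden, hrc]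
  push_cast
  have : ((D a : ℕ) : ℚ) + D c < s + r a := by exact_mod_cast hthin
  linarith

end IsolationTransfer

end Summit.ResolutionOfSingularities.ResolutionOfSingularities.Theorems.LossPolygon
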